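import Mathlib
import Literature.RingTheory.LocalCohomology.CechFiniteness
import Literature.RingTheory.LocalCohomology.CechDepth
import Summits.Langlands.Langlands.Theorems.SkinnerWilesDefectOneReducibleOrdinaryProModularHartshorneConnectedness
import Summits.Langlands.Langlands.Theorems.SkinnerWilesDefectOneReducibleOrdinaryProModularCohenMacaulayConnectedness
import Summits.Langlands.Langlands.Theorems.SkinnerWilesDefectOneReducibleOrdinaryProModularCechIdempotentLift

/-!
# The algebraic local Lefschetz theorem: punctured `V(f)` is connected (HLVT-free)

Route `SkinnerWilesDefectOne`, crux `ReducibleOrdinaryProModular` (stmt-Langlands-12919), line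
`fine-selmer-codimension-two`, stub (R) `stub_raynaudConnectedness` = Grothendieck's connectedness
theorem [SGA 2 XIII 2.1] (`Literature.RingTheory.LocalCohomology.GrothendieckConnectedness`, reduced to
that named fact by `…GrothendieckConnectednessReduction.lean`).  The lead's (c3) proof of XIII 2.1 follows
Grothendieck's own sketch (SGA 2 XIII §2, p. 95 of arXiv:math/0511279) with two substitutions: the
normalisation is replaced by the reflexive hull over the Cohen subring (`…ReflexiveHull.lean`), and the
"rappel" — the local Lefschetz theorem SGA 2 X 2.1, "`Y' = X' ∩ V(f)` is connected if `X'` is connected,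
`prof 𝒪_{X',x} ≥ 2` at closed points and `f` is regular", classically proved through `Lef(X, Y)` and
formal functions, or through the Hartshorne–Lichtenbaum vanishing theorem — is replaced by the following
ALGEBRAIC statement, proved here on the tree's ordered Čech complex without completeness, formal
functions, local duality or HLVT:

* `Theorems.crossing_one_quotSMulTop_of_smul_H2_eq_zero` — **B Noetherian local, `y ⊆ 𝔪` with
  `𝔪 ⊆ √(y)`, `f ∈ 𝔪` a non-zero-divisor, an `B`-regular pair in `√(y)` (depth `≥ 2`), and
  `f^N · H²(y; B) = 0` ⟹ the punctured spectrum of `B/fB` is connected** (crossing form on the minimal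
  primes of `B/fB`);
* `Theorems.crossing_one_quotient_span_of_smul_H2_eq_zero` — the same for `B ⧸ (f)`;
* the ingredients `Theorems.eq_zero_of_cechAug_quot_eq_zero` (`H⁰(B/fB) = 0` from depth `B ≥ 2`),
  `Theorems.le_of_forall_pow_mem`, `Theorems.isIdempotentElem_eq_zero_or_eq_one`, and the registered
  sub-goal `stub_raynaudConnectedness_auxLefschetz` (§7).

Proof (module docstring of the main theorem has the details): a disconnection yields an idempotent
`0`-cocycle of `Č(y; B/fB)` (the splitting cocycle of `…CechIdempotentLift.lean`), which lifts to an
idempotent cocycle modulo `f^{N+1}` (nil-thickening); the connecting construction of the tree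
(`exists_cocycle_of_Z0_quot`) and `f^N · H² = 0` push it back to an element of `B/fB`, an idempotent of a
local ring, hence trivial.  The hypothesis `f^N · H²(y; B) = 0` is how "dim ≥ 3" enters: it holds when `B`
is a second syzygy over a regular local ring of dimension `≥ 3` (lemma (H1b) of the programme).

References: A. Grothendieck, SGA 2, Exp. X 2.1, Exp. XIII §2 [Grothendieck1968SGA2]; R. Hartshorne,
Amer. J. Math. 84 (1962) [Hartshorne1962]; The Stacks Project, Tag 00J9, Tag 01FG [StacksProject].
-/

set_option linter.dupNamespace false -- project-wide option (lakefile weak.linter.dupNamespace); `Summit.Langlands.Langlands` is the mandated namespace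
set_option autoImplicit false

noncomputable section

namespace Summit.Langlands.Langlands.Theorems

open Literature.RingTheory.LocalCohomology

universe u

/-! ## 5. `H⁰` of the hypersurface vanishes; small ring lemmas -/

section Lefschetz

variable {B : Type u} [CommRing B] {s : ℕ} (y : Fin s → B)

open Pointwise IsLocalRing RingTheory.Sequence

/-- The ideal `f • ⊤` cut out by `QuotSMulTop f B` is the principal ideal `(f)`. [folklore] -/
theorem smul_top_eq_span_singleton (f : B) : (f • (⊤ : Submodule B B) : Ideal B) = Ideal.span {f} := by
  rw [← Submodule.ideal_span_singleton_smul, smul_eq_mul, Ideal.mul_top]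

/-- `f • ⊤ ≤ 𝔪` for `f ∈ 𝔪`. [folklore] -/
theorem smul_top_le_maximalIdeal [IsLocalRing B] {f : B} (hf : f ∈ maximalIdeal B) :
    (f • (⊤ : Submodule B B) : Ideal B) ≤ maximalIdeal B := by
  rw [smul_top_eq_span_singleton, Ideal.span_singleton_le_iff_mem]
  exact hf

/-- `B/fB` is local for `f ∈ 𝔪`. [folklore] -/
theorem isLocalRing_quotSMulTop [IsLocalRing B] {f : B} (hf : f ∈ maximalIdeal B) :
    IsLocalRing (QuotSMulTop f B) :=
  have : Nontrivial (QuotSMulTop f B) :=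
    Ideal.Quotient.nontrivial_iff.mpr
      (ne_top_of_le_ne_top (Ideal.IsMaximal.ne_top inferInstance) (smul_top_le_maximalIdeal hf))
  IsLocalRing.of_surjective' (Ideal.Quotient.mk _) Ideal.Quotient.mk_surjective

/-- A surjection of local rings with kernel in `𝔪` maps `𝔪` into `𝔪`. [folklore] -/
theorem map_mem_maximalIdeal_of_surjective [IsLocalRing B] {A : Type u} [CommRing A] [IsLocalRing A]
    (π : B →+* A) (hπ : Function.Surjective π) (hker : RingHom.ker π ≤ maximalIdeal B) {x : B}
    (hx : x ∈ maximalIdeal B) : π x ∈ maximalIdeal A := by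
  by_contra hu
  rw [IsLocalRing.mem_maximalIdeal, mem_nonunits_iff, not_not] at hu
  obtain ⟨v, hv⟩ := hu.exists_right_inv
  obtain ⟨b, rfl⟩ := hπ v
  have hk : x * b - 1 ∈ RingHom.ker π := by
    rw [RingHom.mem_ker, map_sub, map_mul, map_one, hv, sub_self]
  have h1 : (1 : B) ∈ maximalIdeal B := by
    have := (maximalIdeal B).sub_mem ((maximalIdeal B).mul_mem_right b hx) (hker hk)
    rwa [sub_sub_cancel] at this
  exact (IsLocalRing.maximalIdeal.isMaximal B).ne_top ((Ideal.eq_top_iff_one _).mpr h1)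

/-- **`H⁰_𝔪(B/fB) = 0` from `depth B ≥ 2`.**  If `Č(y; B)` is exact in degrees `< 2` (no section of
`B` vanishes on all `D(y_i)`, every `0`-cocycle comes from `B`) and `f` is `B`-regular, then no
non-zero element of `B/fB` vanishes on all `D(y_i)`.  (Lift, write the augmentation as `f • c₀`,
`d c₀ = 0`, so `c₀` comes from `B`.) [folklore] -/
theorem eq_zero_of_cechAug_quot_eq_zero {f : B} (hfreg : IsSMulRegular B f)
    (h0 : ∀ m : B, cechAug y B m = 0 → m = 0)
    (h1 : ∀ c : CechObj y B 0, dC 0 c = 0 → ∃ m : B, cechAug y B m = c)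
    (m : QuotSMulTop f B) (hm : cechAug y (QuotSMulTop f B) m = 0) : m = 0 := by
  obtain ⟨m, rfl⟩ := toQuot_surjective (M := B) f m
  have h : cechObjMap y (toQuot (M := B) f) 0 (cechAug y B m) = 0 := by
    rw [← cechAug_map]; exact hm
  obtain ⟨c₀, hc₀⟩ := exists_eq_smul_of_cechObjMap_toQuot_eq_zero f 0 _ h
  have hd : dC 0 c₀ = 0 := by
    have := dC_cechAug (y := y) m
    rw [hc₀, LinearMap.map_smul] at this
    exact isSMulRegular_cechObj hfreg 1 (by simpa using this)
  obtain ⟨m₀, hm₀⟩ := h1 c₀ hd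
  have hmm : m = f • m₀ := by
    apply sub_eq_zero.mp
    apply h0
    rw [map_sub, LinearMap.map_smul, hm₀, ← hc₀, sub_self]
  rw [hmm]
  exact (Submodule.Quotient.mk_eq_zero _).mpr (Submodule.smul_mem_pointwise_smul m₀ f ⊤ trivial)

/-- Scalars pass through `H2.mk`. [folklore] -/
theorem smul_H2_mk {M : Type u} [AddCommGroup M] [Module B M] (r : B) (z : CechObj y M 1)
    (hz : dC 1 z = 0) :
    r • H2.mk (y := y) (M := M) z hz = H2.mk (r • z) (by rw [map_smul, hz, smul_zero]) :=
  rfl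

/-- If every `y_i` has a power in the prime `C₁` of a quotient `A` of the local ring `B` and
`𝔪_B ⊆ √(y)`, then `C₁` lies above every proper ideal of `A` (it is the maximal ideal). [folklore] -/
theorem le_of_forall_pow_mem [IsLocalRing B] {A : Type u} [CommRing A] (π : B →+* A)
    (hπ : Function.Surjective π) (hrad : maximalIdeal B ≤ (Ideal.span (Set.range y)).radical)
    {C₁ : Ideal A} (hC₁ : C₁.IsPrime) (hy : ∀ i, ∃ k : ℕ, π (y i) ^ k ∈ C₁)
    (C₂ : Ideal A) (hC₂ : C₂ ≠ ⊤) : C₂ ≤ C₁ := by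
  have hP : (C₁.comap π).IsPrime := Ideal.comap_isPrime π C₁
  have hyP : ∀ i, y i ∈ C₁.comap π := fun i => by
    obtain ⟨k, hk⟩ := hy i
    exact hP.mem_of_pow_mem k (by rw [Ideal.mem_comap, map_pow]; exact hk)
  have hmP : maximalIdeal B ≤ C₁.comap π := by
    refine hrad.trans ((hP.radical_le_iff).mpr ?_)
    rw [Ideal.span_le]
    rintro _ ⟨i, rfl⟩
    exact hyP i
  have h2 : C₂.comap π ≤ C₁.comap π :=
    (IsLocalRing.le_maximalIdeal (Ideal.comap_ne_top π hC₂)).trans hmP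
  calc C₂ = (C₂.comap π).map π := (Ideal.map_comap_of_surjective π hπ C₂).symm
    _ ≤ (C₁.comap π).map π := Ideal.map_mono h2
    _ = C₁ := Ideal.map_comap_of_surjective π hπ C₁

/-- An idempotent of a local ring is `0` or `1`. [folklore] -/
theorem isIdempotentElem_eq_zero_or_eq_one {A : Type u} [CommRing A] [IsLocalRing A]
    {e : A} (he : IsIdempotentElem e) : e = 0 ∨ e = 1 := by
  rcases IsLocalRing.isUnit_or_isUnit_one_sub_self e with hu | hu
  · right
    have h : e * (e - 1) = 0 := by rw [mul_sub, mul_one, he.eq, sub_self]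
    exact sub_eq_zero.mp ((hu.mul_right_eq_zero).mp h)
  · left
    have h : (1 - e) * e = 0 := by rw [sub_mul, one_mul, he.eq, sub_self]
    exact (hu.mul_right_eq_zero).mp h

/-! ## 6. The algebraic local Lefschetz theorem -/

/-- **The algebraic local Lefschetz theorem** (the "rappel" of SGA 2 XIII §2 = X 2.1, in the form used
by the lead's proof of XIII 2.1; HLVT-free, completeness-free).  Let `B` be a Noetherian local ring,
`y_1, …, y_s ∈ 𝔪` with `𝔪 ⊆ √(y)`, `f ∈ 𝔪` a non-zero-divisor; suppose `B` has a `B`-regular pair in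
`√(y)` (depth `≥ 2`) and that a power of `f` kills `H²(y; B)` (e.g. `H²_𝔪(B)` of finite length).  Then
the punctured spectrum of `B/fB` is connected: for every two-colouring of the minimal primes of `B/fB`
using both colours, two minimal primes `C₁, C₂` of different colours have `1 ≤ dim (B/fB)/(C₁ + C₂)`.
Proof: a disconnection gives colour-class ideals `𝔞, 𝔟` with `𝔞^N 𝔟^N = 0` and `𝔞 + 𝔟` primary, hence
`ȳ_i^K = a_i + b_i` and the idempotent cocycle `e = (b_i / ȳ_i^K)_i ∈ Č⁰(y; B/fB)`; it lifts to an
idempotent cocycle `e'` modulo `f^{N+1}` (`exists_idempotent_cocycle_lift`); the connecting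
construction for `0 → B →f^{N+1} B → B/f^{N+1} → 0` gives `d c = f^{N+1} z` with `c` lifting `e'`, and
`f^N [z] = 0` yields `w` with `d(c − f w) = 0`, so `c − f w` comes from some `b₀ ∈ B` and `e` is the
image of `b̄₀ ∈ B/fB` — an idempotent of a LOCAL ring (`H⁰(B/fB) = 0`), hence `0` or `1`; either value
puts a power of every `ȳ_i` into one colour class, forcing a minimal prime of that colour to be `𝔪` and
the two colours to meet.  [cite: Grothendieck1968SGA2, Exp. XIII §2] -/
theorem crossing_one_quotSMulTop_of_smul_H2_eq_zero [IsNoetherianRing B] [IsLocalRing B]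
    (hy : ∀ i, y i ∈ maximalIdeal B) (hrad : maximalIdeal B ≤ (Ideal.span (Set.range y)).radical)
    {f : B} (hf : f ∈ maximalIdeal B) (hfreg : IsSMulRegular B f)
    (hdepth : ∃ x₁ x₂ : B, IsRegular B [x₁, x₂] ∧ x₁ ∈ (Ideal.span (Set.range y)).radical ∧
      x₂ ∈ (Ideal.span (Set.range y)).radical)
    (hH2 : ∃ N : ℕ, ∀ c : H2 (y := y) (M := B), f ^ N • c = 0)
    (S : Set (PrimeSpectrum (QuotSMulTop f B)))
    (h₁ : ∃ C ∈ S, C.asIdeal ∈ minimalPrimes (QuotSMulTop f B))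
    (h₂ : ∃ C ∉ S, C.asIdeal ∈ minimalPrimes (QuotSMulTop f B)) :
    ∃ C₁ ∈ S, ∃ C₂ ∉ S, C₁.asIdeal ∈ minimalPrimes (QuotSMulTop f B) ∧
      C₂.asIdeal ∈ minimalPrimes (QuotSMulTop f B) ∧
      (1 : WithBot ℕ∞) ≤ ringKrullDim (QuotSMulTop f B ⧸ (C₁.asIdeal ⊔ C₂.asIdeal)) := by
  classical
  haveI hAloc : IsLocalRing (QuotSMulTop f B) := isLocalRing_quotSMulTop hf
  -- notation: `A = B/fB`, `π : B → A`
  set A : Type u := QuotSMulTop f B with hA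
  let π : B →ₐ[B] A := Ideal.Quotient.mkₐ B _
  have hπ : Function.Surjective π := Ideal.Quotient.mk_surjective
  have hπlin : π.toLinearMap = toQuot (M := B) f := rfl
  have hπalg : ∀ b : B, algebraMap B A b = π b := fun _ => rfl
  have hπker : RingHom.ker (π : B →+* A) ≤ maximalIdeal B := by
    intro b hb
    refine smul_top_le_maximalIdeal hf ?_
    exact Ideal.Quotient.eq_zero_iff_mem.mp hb
  -- depth `≥ 2`: exactness of `Č(y; B)` in degrees `< 2`
  obtain ⟨x₁, x₂, hreg, hx₁, hx₂⟩ := hdepth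
  obtain ⟨hE0, hE1, -⟩ := cech_exact_of_isRegular (y := y) [x₁, x₂] B hreg (by
    intro r hr
    simp only [List.mem_cons, List.not_mem_nil, or_false] at hr
    rcases hr with rfl | rfl <;> assumption)
  have h0 : ∀ m : B, cechAug y B m = 0 → m = 0 := hE0 (by simp)
  have h1 : ∀ c : CechObj y B 0, dC 0 c = 0 → ∃ m : B, cechAug y B m = c := hE1 (by simp)
  by_contra H
  push Not at H
  -- Step 1: colour-class ideals; `𝔞^N₁ 𝔟^N₁ = 0`; `𝔪_A^L ≤ 𝔞 + 𝔟`
  obtain ⟨𝔞, 𝔟, h𝔞, h𝔞', h𝔟, h𝔟'⟩ := exists_colouring_ideals S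
  obtain ⟨N₁, hN₁, h0ab⟩ := exists_pow_mul_pow_eq_bot (mul_le_nilradical_of_colouring S h𝔞 h𝔟)
  have hprim : maximalIdeal A ≤ (𝔞 ⊔ 𝔟).radical := by
    intro x hx
    rw [Ideal.radical_eq_sInf, Submodule.mem_sInf]
    rintro P ⟨hP, hPprime⟩
    obtain ⟨C₁, hC₁S, hC₁, hC₁P⟩ := h𝔞' P hPprime (le_sup_left.trans hP)
    obtain ⟨C₂, hC₂S, hC₂, hC₂P⟩ := h𝔟' P hPprime (le_sup_right.trans hP)
    have hlt : ringKrullDim (A ⧸ (C₁.asIdeal ⊔ C₂.asIdeal)) < 1 := H C₁ hC₁S C₂ hC₂S hC₁ hC₂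
    rw [eq_maximalIdeal_of_ringKrullDim_quotient_lt_one hPprime (sup_le hC₁P hC₂P) hlt]
    exact hx
  obtain ⟨L, hL⟩ := Ideal.exists_pow_le_of_le_radical_of_fg hprim (IsNoetherian.noetherian _)
  set K : ℕ := L * (N₁ + N₁) with hK
  have hyK : ∀ i, π (y i) ^ K ∈ 𝔞 ^ N₁ ⊔ 𝔟 ^ N₁ := fun i => by
    have hyi : π (y i) ∈ maximalIdeal A :=
      map_mem_maximalIdeal_of_surjective (π : B →+* A) hπ hπker (hy i)
    have h1 : π (y i) ^ K ∈ maximalIdeal A ^ K := Ideal.pow_mem_pow hyi K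
    have h2 : maximalIdeal A ^ K ≤ 𝔞 ^ N₁ ⊔ 𝔟 ^ N₁ := by
      rw [hK, pow_mul]
      exact (Ideal.pow_right_mono hL _).trans Ideal.sup_pow_add_le_pow_sup_pow
    exact h2 h1
  have hsplit : ∀ i, ∃ a ∈ 𝔞 ^ N₁, ∃ b ∈ 𝔟 ^ N₁, a + b = π (y i) ^ K := fun i =>
    Submodule.mem_sup.mp (hyK i)
  choose a ha b hb hsum using hsplit
  have hab : ∀ i j, a i * b j = 0 := fun i j => by
    have := Ideal.mul_mem_mul (ha i) (hb j)
    rwa [h0ab, Ideal.mem_bot] at this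
  have hsum' : ∀ i, algebraMap B A (y i) ^ K = a i + b i := fun i => by rw [hπalg, hsum]
  -- Step 2: the idempotent cocycle `e` of `Č⁰(y; A)`
  set e : CechObj y A 0 :=
    fun t => LocalizedModule.mk (b (t 0)) ⟨tupleProd y t ^ K, pow_mem_powers_tupleProd y t K⟩ with he_def
  have he : dC 0 e = 0 := dC_splittingCocycle y K a b hab hsum'
  have hid : ∀ t, IsIdempotentElem (e t) := fun t =>
    isIdempotentElem_splittingCocycle y K a b (fun i => hab i i) hsum' t
  -- Step 3: the thickening `A' = B/f^{N+1}B → A`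
  obtain ⟨N, hN⟩ := hH2
  have hle : ((f ^ (N + 1)) • (⊤ : Submodule B B) : Ideal B) ≤ (f • (⊤ : Submodule B B) : Ideal B) := by
    rw [smul_top_eq_span_singleton, smul_top_eq_span_singleton, Ideal.span_singleton_le_span_singleton]
    exact dvd_pow_self f (Nat.succ_ne_zero N)
  let φ : QuotSMulTop (f ^ (N + 1)) B →ₐ[B] A := Ideal.Quotient.factorₐ B hle
  have hφmk : ∀ b : B, φ (toQuot (M := B) (f ^ (N + 1)) b) = π b := fun _ => rfl
  have hφsurj : Function.Surjective φ := fun x => by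
    obtain ⟨b, rfl⟩ := hπ x
    exact ⟨toQuot (M := B) (f ^ (N + 1)) b, hφmk b⟩
  have hφnil : ∀ x, φ x = 0 → IsNilpotent x := fun x hx => by
    obtain ⟨b, rfl⟩ := toQuot_surjective (M := B) (f ^ (N + 1)) x
    rw [hφmk] at hx
    have hb : b ∈ (f • (⊤ : Submodule B B) : Ideal B) := Ideal.Quotient.eq_zero_iff_mem.mp hx
    obtain ⟨b', -, rfl⟩ := (Submodule.mem_smul_pointwise_iff_exists b f ⊤).mp hb
    refine ⟨N + 1, ?_⟩
    change toQuot (M := B) (f ^ (N + 1)) ((f • b') ^ (N + 1)) = 0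
    refine (Submodule.Quotient.mk_eq_zero _).mpr ?_
    rw [smul_eq_mul, mul_pow]
    exact Submodule.smul_mem_pointwise_smul _ _ ⊤ trivial
  have hφcomp : φ.toLinearMap ∘ₗ toQuot (M := B) (f ^ (N + 1)) = toQuot (M := B) f := rfl
  -- Step 4: lift `e` to an idempotent cocycle `e'` modulo `f^{N+1}`
  obtain ⟨e', hmap, he', -⟩ := exists_idempotent_cocycle_lift y φ hφsurj hφnil e he hid
  -- Step 5: connecting construction for `0 → B →f^{N+1} B → B/f^{N+1} → 0`
  have hx : IsSMulRegular B (f ^ (N + 1)) := hfreg.pow (N + 1)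
  obtain ⟨c, z, hc, hcz, hz⟩ := exists_cocycle_of_Z0_quot hx e' he'
  -- Step 6: `f^N [z] = 0`
  have hz' : dC 1 (f ^ N • z) = 0 := by rw [LinearMap.map_smul, hz, smul_zero]
  have hfz : H2.mk (y := y) (M := B) (f ^ N • z) hz' = 0 := by
    have := hN (H2.mk (y := y) (M := B) z hz)
    rw [smul_H2_mk] at this
    exact this
  obtain ⟨w, hw⟩ := (H2.mk_eq_zero_iff _ _).mp hfz
  -- Step 7: `c − f w` is a cocycle, hence comes from `B`
  have hd' : dC 0 (c - f • w) = 0 := by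
    rw [map_sub, LinearMap.map_smul, hcz, hw, ← mul_smul, ← pow_succ', sub_self]
  obtain ⟨b₀, hb₀⟩ := h1 _ hd'
  -- Step 8: `e` is the augmentation of `b̄₀ = π b₀`
  have hkey : cechAug y A (π b₀) = e := by
    have hcomp : cechObjMap y (toQuot (M := B) f) 0 c = e := by
      rw [← hφcomp, cechObjMap_comp, LinearMap.comp_apply, hc, hmap]
    have h3 : f • cechObjMap y (toQuot (M := B) f) 0 w = 0 := smul_cechObj_quot f 0 _
    calc cechAug y A (π b₀) = cechObjMap y π.toLinearMap 0 (cechAug y B b₀) :=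
          cechAug_map π.toLinearMap b₀
      _ = cechObjMap y (toQuot (M := B) f) 0 (c - f • w) := by rw [hπlin, hb₀]
      _ = e := by rw [map_sub, LinearMap.map_smul, hcomp, h3, sub_zero]
  -- Step 9/10: `b̄₀` is idempotent (`H⁰(A) = 0`)
  set bb : A := π b₀ with hbb_def
  have hbb : IsIdempotentElem bb := by
    apply sub_eq_zero.mp
    apply eq_zero_of_cechAug_quot_eq_zero y hfreg h0 h1
    funext t
    have ht := hid t
    rw [← hkey, cechAug_apply] at ht
    rw [map_sub, Pi.sub_apply, cechAug_apply, cechAug_apply, Pi.zero_apply, sub_eq_zero,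
      ← ht.eq, LocalizedModule.mk_mul_mk, one_mul]
  -- Step 11/12: `b̄₀ = 0` or `1`; both are absurd
  obtain ⟨C₁, hC₁S, hC₁⟩ := h₁
  obtain ⟨C₂, hC₂S, hC₂⟩ := h₂
  -- the component of `e` at `i`
  have hcomp : ∀ i : Fin s, ∃ k : ℕ, π (y i) ^ k * (π (y i) ^ K * bb) = π (y i) ^ k * b i := by
    intro i
    have hi := congrFun hkey (fun _ => i)
    rw [cechAug_apply, he_def, LocalizedModule.mk_eq] at hi
    obtain ⟨u, hu⟩ := hi
    obtain ⟨_, k, rfl⟩ := u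
    refine ⟨k, ?_⟩
    have htp : tupleProd y (fun _ : Fin 1 => i) = y i := by rw [tupleProd_fin_one]
    simp only [Submonoid.smul_def, one_smul, htp, Algebra.smul_def, hπalg, map_pow] at hu
    simpa [mul_assoc] using hu
  rcases isIdempotentElem_eq_zero_or_eq_one hbb with h0 | h1
  · -- `b̄₀ = 0`: a power of every `ȳ_i` lies in `𝔞 ≤ C₁`, so `C₂ ≤ C₁`, `C₂ = C₁`
    have hyC₁ : ∀ i, ∃ k : ℕ, (π : B →+* A) (y i) ^ k ∈ C₁.asIdeal := fun i => by
      obtain ⟨k, hk⟩ := hcomp i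
      rw [h0, mul_zero, mul_zero] at hk
      refine ⟨k + K, h𝔞 C₁ hC₁S hC₁ (Ideal.pow_le_self hN₁.ne' ?_)⟩
      have : (π : B →+* A) (y i) ^ (k + K) = π (y i) ^ k * a i := by
        rw [pow_add, AlgHom.coe_toRingHom, ← hπalg, hsum', mul_add, hπalg, ← hk, add_zero]
      rw [this]
      exact Ideal.mul_mem_left _ _ (ha i)
    have hle₂₁ : C₂.asIdeal ≤ C₁.asIdeal :=
      le_of_forall_pow_mem y (π : B →+* A) hπ hrad C₁.isPrime hyC₁ C₂.asIdeal C₂.isPrime.ne_top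
    exact hC₂S (PrimeSpectrum.eq_of_mem_minimalPrimes_of_le hC₁ hle₂₁ ▸ hC₁S)
  · -- `b̄₀ = 1`: a power of every `ȳ_i` lies in `𝔟 ≤ C₂`, so `C₁ ≤ C₂`, `C₁ = C₂`
    have hyC₂ : ∀ i, ∃ k : ℕ, (π : B →+* A) (y i) ^ k ∈ C₂.asIdeal := fun i => by
      obtain ⟨k, hk⟩ := hcomp i
      rw [h1, mul_one, ← pow_add] at hk
      refine ⟨k + K, h𝔟 C₂ hC₂S hC₂ (Ideal.pow_le_self hN₁.ne' ?_)⟩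
      rw [AlgHom.coe_toRingHom, hk]
      exact Ideal.mul_mem_left _ _ (hb i)
    have hle₁₂ : C₁.asIdeal ≤ C₂.asIdeal :=
      le_of_forall_pow_mem y (π : B →+* A) hπ hrad C₂.isPrime hyC₂ C₁.asIdeal C₁.isPrime.ne_top
    exact hC₂S (PrimeSpectrum.eq_of_mem_minimalPrimes_of_le hC₂ hle₁₂ ▸ hC₁S)

end Lefschetz

section Transport

variable {B : Type u} [CommRing B] {s : ℕ} (y : Fin s → B)

open Pointwise IsLocalRing RingTheory.Sequence

/-- **The algebraic local Lefschetz theorem for `B ⧸ (f)`**: `crossing_one_quotSMulTop_of_smul_H2_eq_zero`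
transported along `B ⧸ f • ⊤ ≃ B ⧸ (f)`. [cite: Grothendieck1968SGA2, Exp. XIII §2] -/
theorem crossing_one_quotient_span_of_smul_H2_eq_zero [IsNoetherianRing B] [IsLocalRing B]
    (hy : ∀ i, y i ∈ maximalIdeal B) (hrad : maximalIdeal B ≤ (Ideal.span (Set.range y)).radical)
    {f : B} (hf : f ∈ maximalIdeal B) (hfreg : IsSMulRegular B f)
    (hdepth : ∃ x₁ x₂ : B, IsRegular B [x₁, x₂] ∧ x₁ ∈ (Ideal.span (Set.range y)).radical ∧
      x₂ ∈ (Ideal.span (Set.range y)).radical)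
    (hH2 : ∃ N : ℕ, ∀ c : H2 (y := y) (M := B), f ^ N • c = 0)
    (S : Set (PrimeSpectrum (B ⧸ Ideal.span {f})))
    (h₁ : ∃ C ∈ S, C.asIdeal ∈ minimalPrimes (B ⧸ Ideal.span {f}))
    (h₂ : ∃ C ∉ S, C.asIdeal ∈ minimalPrimes (B ⧸ Ideal.span {f})) :
    ∃ C₁ ∈ S, ∃ C₂ ∉ S, C₁.asIdeal ∈ minimalPrimes (B ⧸ Ideal.span {f}) ∧
      C₂.asIdeal ∈ minimalPrimes (B ⧸ Ideal.span {f}) ∧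
      (1 : WithBot ℕ∞) ≤ ringKrullDim ((B ⧸ Ideal.span {f}) ⧸ (C₁.asIdeal ⊔ C₂.asIdeal)) :=
  crossing_of_ringEquiv (Ideal.quotEquivOfEq (smul_top_eq_span_singleton f)).symm 1
    (crossing_one_quotSMulTop_of_smul_H2_eq_zero y hy hrad hf hfreg hdepth hH2) S h₁ h₂

end Transport

end Summit.Langlands.Langlands.Theorems

/-! ## 7. The registered sub-goal (verbatim signature) -/

namespace Summit.Langlands.Langlands.Cruxes.ReducibleOrdinaryProModular.FineSelmerCodimensionTwo

/-- **Registered sub-goal `stub_raynaudConnectedness_auxLefschetz` of stub (R) `stub_raynaudConnectedness`**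
(c3, SGA 2 XIII 2.1 programme, step (G5)): the algebraic local Lefschetz theorem,
`Theorems.crossing_one_quotient_span_of_smul_H2_eq_zero` at universe `0`.
[cite: Grothendieck1968SGA2, Exp. XIII §2] -/
theorem stub_raynaudConnectedness_auxLefschetz :
    ∀ (B : Type) [CommRing B] [IsNoetherianRing B] [IsLocalRing B] (s : ℕ) (y : Fin s → B) (f : B), (∀ i, y i ∈ IsLocalRing.maximalIdeal B) → IsLocalRing.maximalIdeal B ≤ (Ideal.span (Set.range y)).radical → f ∈ IsLocalRing.maximalIdeal B → IsSMulRegular B f → (∃ x₁ x₂ : B, RingTheory.Sequence.IsRegular B [x₁, x₂] ∧ x₁ ∈ (Ideal.span (Set.range y)).radical ∧ x₂ ∈ (Ideal.span (Set.range y)).radical) → (∃ N : ℕ, ∀ c : Literature.RingTheory.LocalCohomology.H2 (y := y) (M := B), f ^ N • c = 0) → ∀ S : Set (PrimeSpectrum (B ⧸ Ideal.span {f})), (∃ C ∈ S, C.asIdeal ∈ minimalPrimes (B ⧸ Ideal.span {f})) → (∃ C ∉ S, C.asIdeal ∈ minimalPrimes (B ⧸ Ideal.span {f})) → ∃ C₁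 ∈ S, ∃ C₂ ∉ S, C₁.asIdeal ∈ minimalPrimes (B ⧸ Ideal.span {f}) ∧ C₂.asIdeal ∈ minimalPrimes (B ⧸ Ideal.span {f}) ∧ (1 : WithBot ℕ∞) ≤ ringKrullDim ((B ⧸ Ideal.span {f}) ⧸ (C₁.asIdeal ⊔ C₂.asIdeal)) :=
  fun _B _ _ _ _s y _f hy hrad hf hfreg hdepth hH2 S h₁ h₂ =>
    Summit.Langlands.Langlands.Theorems.crossing_one_quotient_span_of_smul_H2_eq_zero y hy hrad hf hfreg
      hdepth hH2 S h₁ h₂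

end Summit.Langlands.Langlands.Cruxes.ReducibleOrdinaryProModular.FineSelmerCodimensionTwo

end
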